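import Summits.QuantumFields.YangMills.Theorems.BalabanUVNodesN15KingModelTranslationCovariance
import Summits.QuantumFields.YangMills.Theorems.BalabanUVNodesN15KingModelFreeRGBlockSpinStep

/-!
# BalabanUVNodes ∕ N15 — THE KING-MODEL RUNG (PART Ϙ-e): KING's RENORMALIZATION TRANSFORMATION COMMUTES WITH LATTICE TRANSLATIONS, AND THE FREE FIELD's
# RENORMALIZATION-GROUP DATA (`Δ^{(k)}`, `S^{(k),1}`, `χ_k`) ARE TRANSLATION INVARIANT AT EVERY SCALE
# (Track A, DAG node N15 = NE2; FAN-OUT v1.1 §N15 s3 «KING-MODEL RUNG … NE2's analogue DECIDED in the model»)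

HONEST FRAMING.  Count-neutral (cell `pub-ymgap`, seat `pub-ymgap-dag-n15-e` g31; `--supports stmt-QuantumFields-27366 --as helper` = K3⁸
`SpineGivenEndpointR13SepCoPHV`).  TEMPLATE LITERATURE: C. King, *The U(1) Higgs model. I. The continuum limit*, Commun. Math. Phys. **102** (1986) 649–677
[King1986] — the FREE massive lattice scalar field at `A = 0` (parts Τ-e∕Τ-i's datum `kingFreeRG`: `kingFreeOp`, `kingFreeS`, `kingFreeChi`, the rescaled block
mean `kingBlockAvg`, the Gaussian block-spin step `exp_neg_kingFreeS_succ`).  NOT Bałaban's gauge-covariant transformation; NOT a node discharge (N15 is booked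
through n15-a's knit, untouched here); nothing continuum ∕ ℝ⁴ ∕ OS ∕ mass-gap ∕ Clay.  0 `sorry`; standard axioms.  Sequel of part Ϙ-a (`…TranslationCovariance`:
`effLaplacian_transl`, `Qmat_transl`, `mulVec_transl`, `torCongr_add`) with part Τ-i's transport engine (`quad_submatrix_comp`, `dotProduct_comp_equiv`,
`integral_comp_equiv_fun` = Lebesgue measure on `ℝ^T` is invariant under re-indexing the sites).

THE PRINT.  (2.4) p. 652 ∕ (2.10) p. 653 ∕ (3.14)–(3.15) p. 657: the renormalization transformation `(T_{a,L}F)(φ′) = ∫ dφ exp[−(a∕2)Σ_y|φ′(y) − (Q̃φ)(y)|²] F(φ)`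
with the block mean `Q̃` over the `L`-blocks; a translation of the coarse lattice by `v` is a translation of the fine lattice by `L·v` on the blocks, so `T_{a,L}`
intertwines the two translations, and the effective actions `S^{(k),1}` of a translation-invariant bare action are translation invariant — the symmetry King's
effective actions carry tacitly ((3.17) p. 657 lists the terms of `S^{(k),1}` as sums over the lattice of local densities with position-independent coefficients;
§4 diagonalises `Δ^{(k)}` by plane waves, (4.1)–(4.5) p. 670).

WHAT THIS FILE PROVES (kernel; 0 `def`).  §1 `dotProduct_mulVec_transl` (generic: `⟨φ∘τ_v, T(φ∘τ_v)⟩ = ⟨φ, Tφ⟩` for translation-invariant `T`), ★ `kingFreeOp_transl`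
(`Δ^{(k)}` of the run, every `k`, incl. the bare `−Δ¹ + m²ε_m²`), ★★ **`kingFreeS_transl`** (`S^{(k),1}(φ∘τ_v) = S^{(k),1}(φ)` — THE FREE EFFECTIVE ACTIONS ARE
TRANSLATION INVARIANT AT EVERY SCALE), ★ `kingFreeChi_transl` (the small-field function (3.2) is translation invariant).  §2 ★★ **`kingBlockAvg_transl`** (the
rescaled block mean intertwines the fine translation by `L·v` with the coarse translation by `v`: `Q̃(φ∘τ_{L·v}) = (Q̃φ)∘τ_v`).  §3 ★★★ **`blockSpin_integral_transl`**
(KING's RENORMALIZATION TRANSFORMATION COMMUTES WITH TRANSLATIONS: `(T_{a,L}G)(φ′∘τ_v) = T_{a,L}(G∘τ_{L·v})(φ′)` for every integrand `G` — change of variables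
`φ ↦ φ∘τ_{L·v}` under which Lebesgue measure is invariant), ★★ `blockSpin_integral_transl_of_invariant` (hence `T_{a,L}` of a translation-invariant density is
translation invariant), ★★ `exp_neg_kingFreeS_succ_transl` (both sides of part Τ-i's RG-step identity at the translated field, consistently).

HONEST SCOPE.  Torus ∕ periodic b.c., flat block mean, `A = 0`, free field; the small-field function is the φ-clause of (3.2) only (part Τ-e (ii)).  Nothing here is an
estimate.  N15 untouched; counts unmoved.
Locators: [King1986] (2.4)–(2.6) p.652, (2.10)–(2.14) pp.652–653, (2.20) p.654, (3.2) p.655, (3.14)–(3.17) p.657, (4.1)–(4.5) p.670.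
-/

noncomputable section

open scoped BigOperators
open Real Finset Matrix MeasureTheory

namespace Summit.QuantumFields.YangMills.BalabanUVNodes.N15KingModelRung.FreeField

open Literature.MathematicalPhysics.QuantumFieldTheory.Balaban1983to89.B5Prop11Plancherel (Tor fine)
open Literature.MathematicalPhysics.QuantumFieldTheory.Balaban1983to89 (B5Block118.up B5Block118.up_add)
open Literature.MathematicalPhysics.QuantumFieldTheory.King1986.Torus (effLaplacian lapF lapF_transl Qmat torCongr torCongr_add)
open Summit.QuantumFields.YangMills.BalabanUVNodes.N15KingModelRung.Transl

variable {d : ℕ} (L : ℕ) [NeZero L] (M₀ : ℕ) [NeZero M₀]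

/-! ## §1 The free field's effective operators, effective actions and small-field function -/

section Actions

omit [NeZero L] [NeZero M₀] in
/-- Quadratic forms of translation-invariant operators are translation invariant: `⟨φ∘τ_v, T(φ∘τ_v)⟩ = ⟨φ, Tφ⟩`. [cite: King1986, (4.1)–(4.5) p.670] -/
theorem dotProduct_mulVec_transl {N : Fin d → ℕ} [∀ μ, NeZero (N μ)] (T : Matrix (Tor N) (Tor N) ℝ) {v : Tor N}
    (hT : ∀ x y, T (x + v) (y + v) = T x y) (φ : Tor N → ℝ) :
    (fun y => φ (y + v)) ⬝ᵥ (T *ᵥ fun y => φ (y + v)) = φ ⬝ᵥ (T *ᵥ φ) := by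
  have h := quad_submatrix_comp (Equiv.addRight v) T φ
  rw [(submatrix_addRight_eq_iff T v v).2 hT] at h
  exact h

/-- ★ **THE RUN's EFFECTIVE OPERATORS ARE TRANSLATION INVARIANT**, every `k` (`k = 0`: the bare `−Δ¹ + m²ε_m²`; `k ≥ 1`: `Δ^{(k)}`, part Ϙ-a `effLaplacian_transl`).
[cite: King1986, (2.4) p.652, (2.14) p.653, (4.5) p.670] -/
theorem kingFreeOp_transl (a msq : ℝ) (m k : ℕ) (y y' v : Tor (cubeSide (d := d) M₀ L m)) :
    kingFreeOp L M₀ a msq m k (y + v) (y' + v) = kingFreeOp (d := d) L M₀ a msq m k y y' := by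
  cases k with
  | zero => exact lapF_transl _ _ _ y y' v
  | succ k => exact effLaplacian_transl (L ^ (k + 1)) (cubeSide (d := d) M₀ L m) _ _ _ y y' v

/-- ★★ **THE FREE FIELD's EFFECTIVE ACTIONS ARE TRANSLATION INVARIANT AT EVERY SCALE**: `S^{(k),1}(φ∘τ_v) = S^{(k),1}(φ)` (`(φ∘τ_v)(y) = φ(y + v)`).
[cite: King1986, (3.14)–(3.17) p.657, (4.5) p.670] -/
theorem kingFreeS_transl (a msq : ℝ) (m k : ℕ) (φ : Tor (cubeSide (d := d) M₀ L m) → ℝ) (v : Tor (cubeSide (d := d) M₀ L m)) :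
    kingFreeS L M₀ a msq m k (fun y => φ (y + v)) = kingFreeS (d := d) L M₀ a msq m k φ := by
  unfold kingFreeS
  rw [dotProduct_mulVec_transl _ (fun y y' => kingFreeOp_transl L M₀ a msq m k y y' v)]

/-- ★ **THE SMALL-FIELD FUNCTION (3.2) IS TRANSLATION INVARIANT**: `χ_k(φ∘τ_v) = χ_k(φ)` (the sup condition is re-indexed). [cite: King1986, (3.2) p.655] -/
theorem kingFreeChi_transl (b₀ p : ℝ) (m : ℕ) (φ : Tor (cubeSide (d := d) M₀ L m) → ℝ) (v : Tor (cubeSide (d := d) M₀ L m)) :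
    kingFreeChi L M₀ b₀ p m (fun y => φ (y + v)) = kingFreeChi (d := d) L M₀ b₀ p m φ := by
  classical
  have h : (∀ y, |φ (y + v)| ≤ kingFreeThreshold d b₀ p L m) ↔ ∀ y, |φ y| ≤ kingFreeThreshold d b₀ p L m :=
    ⟨fun H y => by have h1 := H (y - v); rwa [sub_add_cancel] at h1, fun H y => H (y + v)⟩
  unfold kingFreeChi
  by_cases H : ∀ y, |φ y| ≤ kingFreeThreshold d b₀ p L m
  · rw [if_pos H, if_pos (h.2 H)]
  · rw [if_neg H, if_neg (fun H' => H (h.1 H'))]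

end Actions

/-! ## §2 The rescaled block mean intertwines fine and coarse translations -/

section BlockMean

/-- ★★ **`Q̃(φ∘τ_{L·v}) = (Q̃φ)∘τ_v`**: translating the fine field by the lift `L·v` (read on the depth-`m+1` spelling of the fine lattice through `torCongr`) and block
averaging is block averaging and translating by `v`. [cite: King1986, (2.10) p.653, (2.20) p.654, (3.15) p.657] -/
theorem kingBlockAvg_transl (m : ℕ) (φ : Tor (cubeSide (d := d) M₀ L (m + 1)) → ℝ) (v : Tor (cubeSide (d := d) M₀ L m)) :
    kingBlockAvg L M₀ m (fun x => φ (x + torCongr (cubeSide_succ L M₀ m) (B5Block118.up L (cubeSide (d := d) M₀ L m) v)))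
      = fun y => kingBlockAvg L M₀ m φ (y + v) := by
  funext y
  unfold kingBlockAvg
  simp only [Pi.smul_apply, smul_eq_mul]
  have hcomp : ((fun x => φ (x + torCongr (cubeSide_succ L M₀ m) (B5Block118.up L (cubeSide (d := d) M₀ L m) v))) ∘ torCongr (cubeSide_succ L M₀ m))
      = fun z => (φ ∘ torCongr (cubeSide_succ L M₀ m)) (z + B5Block118.up L (cubeSide (d := d) M₀ L m) v) := by
    funext z
    simp only [Function.comp_apply, torCongr_add]
  rw [hcomp, mulVec_transl (Qmat L (cubeSide (d := d) M₀ L m)) (fun b z => Qmat_transl L (cubeSide (d := d) M₀ L m) b v z)]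

end BlockMean

/-! ## §3 The renormalization transformation commutes with translations -/

section Step

/-- ★★★ **KING's RENORMALIZATION TRANSFORMATION COMMUTES WITH LATTICE TRANSLATIONS**: for every integrand `G` and Gaussian constant `a`,
`∫dφ e^{−(a∕2)|φ′∘τ_v − Q̃φ|²} G(φ) = ∫dφ e^{−(a∕2)|φ′ − Q̃φ|²} G(φ∘τ_{L·v})` — i.e. `(T_{a,L}G)(φ′∘τ_v) = (T_{a,L}(G∘τ_{L·v}))(φ′)` — by the change of variables
`φ ↦ φ∘τ_{L·v}`, under which Lebesgue measure on `ℝ^{T}` is invariant (part Τ-i `integral_comp_equiv_fun`), and §2. [cite: King1986, (2.4) p.652, (2.10) p.653, (3.14)–(3.15) p.657] -/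
theorem blockSpin_integral_transl (a : ℝ) (m : ℕ) (φ' : Tor (cubeSide (d := d) M₀ L m) → ℝ) (v : Tor (cubeSide (d := d) M₀ L m))
    (G : (Tor (cubeSide (d := d) M₀ L (m + 1)) → ℝ) → ℝ) :
    ∫ φ : Tor (cubeSide (d := d) M₀ L (m + 1)) → ℝ,
        Real.exp (-(1 / 2 : ℝ) * (a * (((fun y => φ' (y + v)) - kingBlockAvg L M₀ m φ) ⬝ᵥ ((fun y => φ' (y + v)) - kingBlockAvg L M₀ m φ)))) * G φ
      = ∫ φ : Tor (cubeSide (d := d) M₀ L (m + 1)) → ℝ,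
        Real.exp (-(1 / 2 : ℝ) * (a * ((φ' - kingBlockAvg L M₀ m φ) ⬝ᵥ (φ' - kingBlockAvg L M₀ m φ))))
          * G (fun x => φ (x + torCongr (cubeSide_succ L M₀ m) (B5Block118.up L (cubeSide (d := d) M₀ L m) v))) := by
  set w := torCongr (cubeSide_succ L M₀ m) (B5Block118.up L (cubeSide (d := d) M₀ L m) v) with hw
  rw [← integral_comp_equiv_fun (Equiv.addRight w) (fun φ : Tor (cubeSide (d := d) M₀ L (m + 1)) → ℝ =>
    Real.exp (-(1 / 2 : ℝ) * (a * (((fun y => φ' (y + v)) - kingBlockAvg L M₀ m φ) ⬝ᵥ ((fun y => φ' (y + v)) - kingBlockAvg L M₀ m φ)))) * G φ)]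
  refine integral_congr_ae (ae_of_all _ fun ψ => ?_)
  have he : (ψ ∘ (Equiv.addRight w)) = fun x => ψ (x + w) := rfl
  simp only [he]
  rw [hw, kingBlockAvg_transl]
  have hdiff : ((fun y => φ' (y + v)) - fun y => kingBlockAvg L M₀ m ψ (y + v)) = (φ' - kingBlockAvg L M₀ m ψ) ∘ (Equiv.addRight v) := by
    funext y; simp only [Pi.sub_apply, Function.comp_apply, Equiv.coe_addRight]
  rw [hdiff, dotProduct_comp_equiv]

/-- ★★ **… HENCE THE BLOCK-SPIN TRANSFORM OF A TRANSLATION-INVARIANT DENSITY IS TRANSLATION INVARIANT**: if `G(φ∘τ_w) = G(φ)` for the lifted translation, then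
`(T_{a,L}G)(φ′∘τ_v) = (T_{a,L}G)(φ′)`. [cite: King1986, (2.4) p.652, (3.14)–(3.15) p.657] -/
theorem blockSpin_integral_transl_of_invariant (a : ℝ) (m : ℕ) (φ' : Tor (cubeSide (d := d) M₀ L m) → ℝ) (v : Tor (cubeSide (d := d) M₀ L m))
    (G : (Tor (cubeSide (d := d) M₀ L (m + 1)) → ℝ) → ℝ)
    (hG : ∀ φ, G (fun x => φ (x + torCongr (cubeSide_succ L M₀ m) (B5Block118.up L (cubeSide (d := d) M₀ L m) v))) = G φ) :
    ∫ φ : Tor (cubeSide (d := d) M₀ L (m + 1)) → ℝ,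
        Real.exp (-(1 / 2 : ℝ) * (a * (((fun y => φ' (y + v)) - kingBlockAvg L M₀ m φ) ⬝ᵥ ((fun y => φ' (y + v)) - kingBlockAvg L M₀ m φ)))) * G φ
      = ∫ φ : Tor (cubeSide (d := d) M₀ L (m + 1)) → ℝ,
        Real.exp (-(1 / 2 : ℝ) * (a * ((φ' - kingBlockAvg L M₀ m φ) ⬝ᵥ (φ' - kingBlockAvg L M₀ m φ)))) * G φ := by
  rw [blockSpin_integral_transl]
  simp only [hG]

/-- ★★ **CONSISTENCY WITH THE RG STEP OF PART Τ-i**: at the translated coarse field both sides of `exp_neg_kingFreeS_succ` are the untranslated ones —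
`e^{−S^{(k+1)}(φ′∘τ_v)} = N·∫dφ e^{−(a∕2)|φ′ − Q̃φ|²} e^{−S^{(k)}(φ)}` (the fine density `e^{−S^{(k)}}` being invariant under `τ_{L·v}`, §1). [cite: King1986, (3.14)–(3.15) p.657] -/
theorem exp_neg_kingFreeS_succ_transl {a msq : ℝ} (ha : 0 < a) (hL : 2 ≤ L) (hmsq : 0 < msq) (m k : ℕ)
    (φ' : Tor (cubeSide (d := d) M₀ L m) → ℝ) (v : Tor (cubeSide (d := d) M₀ L m)) :
    Real.exp (-kingFreeS L M₀ a msq m (k + 1) (fun y => φ' (y + v)))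
      = Real.sqrt (a / (2 * π)) ^ Fintype.card (Tor (cubeSide (d := d) M₀ L m))
        * ∫ φ : Tor (cubeSide (d := d) M₀ L (m + 1)) → ℝ,
            Real.exp (-(1 / 2 : ℝ) * (a * ((φ' - kingBlockAvg L M₀ m φ) ⬝ᵥ (φ' - kingBlockAvg L M₀ m φ))))
              * Real.exp (-kingFreeS L M₀ a msq (m + 1) k φ) := by
  rw [exp_neg_kingFreeS_succ ha hL hmsq m k (fun y => φ' (y + v)),
    blockSpin_integral_transl_of_invariant L M₀ a m φ' v _ (fun φ => by rw [kingFreeS_transl])]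

end Step

end Summit.QuantumFields.YangMills.BalabanUVNodes.N15KingModelRung.FreeField

end
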